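import Literature.IUT.HodgeArakelov.MonoThetaProjectiveProp16EllipticRefChain
import Literature.IUT.HodgeArakelov.MonoThetaProjectiveProp16EllipticRefProofs
import Literature.AnabelianGeometry.AbsoluteAnabelian.AbsTopII.EllipticCuspidalizationChainNonDegeneracy

/-!
# [IUTchII] Prop. 1.6 (ii), successor predicate v2 `RefIsEllipticChain`: re-derivations and NON-DEGENERACY
# (proof-only companion)

PROOF-ONLY companion (theorems only; no `def`, no instance, no named fact) of
`MonoThetaProjectiveProp16EllipticRefChain.lean` (abc-iut cell, seat abc-iut-L6-t2 gen 3, row «REFISELLIPTIC-R2-CHAIN» of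
abc-iut-L6-lead §F v1.19at-ter (1); DAG node **IUTchII:Prop1.6(ii)**, layer L6, outside the [IUTchIII] Cor. 3.12 cone).
S. Mochizuki, *Inter-universal Teichmüller Theory II*, kurims manuscript (Dec. 2020), §1, Prop. 1.6 (ii) p. 31 l. 34–41
("`Π ↦ {Π_{U_N}(Π) ↠ Π}` … such that when `Π = Π^tp_{X̲̲_k}`, the surjection `Π_{U_N}(Π) ↠ Π` may be naturally identified
with … “elliptic cuspidalization” … determined by the `N`-torsion points …") [claim: Mochizuki2012, status: disputed]
(IUTchII §1 Prop 1.6 (ii), kurims p.31); [AbsTopII] Ex. 3.2 (ii) pp. 66–67, Cor. 3.3 (iii)(a) p. 68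
[cite: MochizukiAbsTopII2013, Cor 3.3 (iii)(a) p.68]; [SemiAnbd] §6 p. 69 ("natural injection" `Π^temp ↪ Π̂`, the
profinite completion) [cite: MochizukiSemiAnbd2006, §6 p.69].

## What is proved

* RE-DERIVATIONS over the strengthened predicate, through the projection `RefIsEllipticChain.toRefIsElliptic` (the v2
  predicate EXTENDS v1): `refHom_continuous`, `isClosed_ker`, `inertia_le_ker`, `removed_not_cusp_image`, `exists_level`,
  **`range_aug_comp_refHom`**, **`exists_aug_refHom_eq`** (abc-iut-w5-d030's p439497/p440541 theorems, verbatim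
  conclusions), `transport` (stability under the functorial transport of the output); NEW `exists_level_realizesChain`
  (the level `N` is load-bearing THROUGH THE CHAIN: an [AbsTopII] Cor. 3.3 (iii) record `C` with `C.N = N` realizing the
  printed chain relative to cuspidal data of `Π̂_X`).
* **NON-DEGENERACY** (the point of the row): `RefIsEllipticChain.not_of_completesToIso` — for `N ≥ 2`, NO output whose
  tempered reference surjection `Π^tp_U ↠ Π^tp_X` COMPLETES TO AN ISOMORPHISM of profinite groups (`f : Π̂_U ⥲ Π̂_X` with
  `f ∘ toHat_U = toHat_X ∘ refHom`) satisfies (R2′): by density of `Π^temp ↪ Π̂` ([SemiAnbd] §6) and Hausdorffness the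
  completion square forces the record's OUTPUT `Π_{U_X} ↠ Π'` to be injective, against this seat's L4 lemma
  `AbsTopII.EllipticCuspidalization.RealizesChain.proj_not_injective_of_two_le` (a chain with `N² − 1 ≥ 1`
  de-cuspidalization steps kills a nontrivial (3_Π) cuspidal decomposition group).  COROLLARY
  `not_of_refHom_eq_self` (the identity shape `U = X`, `refHom = id`); the instance AT abc-iut-L6-t21's identity output
  p447116 (`IdentityWitness.not_refIsEllipticChain_idOutput`: it satisfies v1 — `refIsElliptic_idOutput_self` — and FAILS
  v2 for every `N ≥ 2`, every `X`, `eX`) is the sequel file `MonoThetaProjectiveProp16EllipticRefChainIdentityWitness.lean`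
  (filed once p447116's module is built).
  Also `RefIsEllipticChain.exists_isCusp_of_two_le`: under v2 with `N ≥ 2` the curve `X` HAS a cusp recorded by the
  chain's cuspidal data (the tie `IsCuspidalDataOf` is load-bearing).

HONEST SCOPE: statements about the tree's own typed objects; the v2 predicate is not inhabited here (that needs the
tempered fundamental group of `U_X` and a genuine chain-realizing [AbsTopII] record — MERGE-MAP rows 92/141); nothing
takes a side on [IUTchIII] Cor. 3.12 or on any author; typed ≠ proved.
-/

open Topology
open scoped Pointwise

universe u

namespace Literature.IUT.HodgeArakelov

open Literature.AnabelianGeometry.SemiGraphs (TemperedCurve)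
open Literature.AnabelianGeometry.AbsoluteAnabelian (FundamentalExtension)
open Literature.AnabelianGeometry.AbsoluteAnabelian.FundamentalExtension (CuspidalData)
open Literature.AlgebraicGeometry.Frobenioids (IsSlimGroup)

namespace EllipticCuspidalization

variable {S : ThetaSetting.{u}} {N : ℕ+} {P P' : TopGroup.{u}} {p : ℕ} [Fact p.Prime]

namespace RefIsEllipticChain

variable {K : EllipticCuspidalization S N P} {X U : TemperedCurve p} {eX : X.PiTemp ≃ₜ* S.PiX}
  {eU : U.PiTemp ≃ₜ* K.PiURef}

/-! ### Re-derivations through `toRefIsElliptic` -/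

/-- v2 ⇒ v1 (the strengthened predicate extends abc-iut-w5-d030's `RefIsElliptic`).
[claim: Mochizuki2012, status: disputed] (IUTchII §1 Prop 1.6 (ii), kurims p.31) -/
theorem refIsElliptic (h : K.RefIsEllipticChain X U eX eU) : K.RefIsElliptic X U eX eU :=
  h.toRefIsElliptic

/-- Under v2 the reference surjection `Π^tp_U ↠ Π^tp_X` is continuous. [cite: MochizukiSemiAnbd2006, §6 p.73] -/
theorem refHom_continuous (h : K.RefIsEllipticChain X U eX eU) : Continuous (K.refHom X U eX eU) :=
  h.toRefIsElliptic.refHom_continuous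

/-- Under v2 the kernel of `Π^tp_U ↠ Π^tp_X` is closed (`DLoc` shape). [cite: MochizukiSemiAnbd2006, §6 p.73] -/
theorem isClosed_ker (h : K.RefIsEllipticChain X U eX eU) : IsClosed ((K.refHom X U eX eU).ker : Set U.PiTemp) :=
  h.toRefIsElliptic.isClosed_ker

/-- Under v2 the inertia groups of the removed cusps die in `Π^tp_X`. [cite: MochizukiSemiAnbd2006, §6 p.73] -/
theorem inertia_le_ker (h : K.RefIsEllipticChain X U eX eU) :
    ∃ R : Set U.Pt, (∀ x ∈ R, U.IsCusp x) ∧ ∀ x ∈ R, U.inertia x ≤ (K.refHom X U eX eU).ker :=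
  h.toRefIsElliptic.inertia_le_ker

/-- Under v2, [AbsTopII] Cor. 3.3 (iii)(c): the removed cusps lie over NON-cuspidal points of `X`.
[cite: MochizukiAbsTopII2013, Cor 3.3 (iii)(c) p.69] -/
theorem removed_not_cusp_image (h : K.RefIsEllipticChain X U eX eU) :
    ∃ R : Set U.Pt, (K.refHom X U eX eU).ker =
        (Subgroup.normalClosure (⋃ x ∈ R, (U.inertia x : Set U.PiTemp))).topologicalClosure ∧
      ∀ x ∈ R, ∃ y : X.Pt, ¬ X.IsCusp y ∧ X.IsDecompositionGroup ((U.decomp x).map (K.refHom X U eX eU)) :=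
  h.toRefIsElliptic.removed_not_cusp_image

/-- Under v2 the level `N` is load-bearing (an [AbsTopII] Cor. 3.3 (iii) record of level `N`).
[cite: MochizukiAbsTopII2013, Cor 3.3 (iii) p.68] -/
theorem exists_level (h : K.RefIsEllipticChain X U eX eU) :
    ∃ (E : FundamentalExtension.{0})
      (C : Literature.AnabelianGeometry.AbsoluteAnabelian.AbsTopII.EllipticCuspidalization E), C.N = (N : ℕ) :=
  h.toRefIsElliptic.exists_level

/-- **NEW under v2: the level `N` is load-bearing THROUGH THE CHAIN** — an [AbsTopII] Cor. 3.3 (iii) record `C` with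
`C.N = N` which REALIZES the printed chain of `N² − 1` de-cuspidalizations relative to cuspidal data that IS the
cuspidal data of `X`. [cite: MochizukiAbsTopII2013, Cor 3.3 (iii)(a) p.68] -/
theorem exists_level_realizesChain (h : K.RefIsEllipticChain X U eX eU) :
    ∃ (E : FundamentalExtension.{0}) (iX : X.PiHat ≃ₜ* E.arith)
      (C : Literature.AnabelianGeometry.AbsoluteAnabelian.AbsTopII.EllipticCuspidalization E)
      (CD : CuspidalData E) (hP : IsSlimGroup E.arith) (hΔ : IsSlimGroup E.geom) (hne : E.geom ≠ ⊥),
      C.N = (N : ℕ) ∧ IsCuspidalDataOf X iX CD ∧ C.RealizesChain C.Sigma CD hP hΔ hne := by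
  obtain ⟨E, iX, C, -, hN, -, -, CD, hP, hΔ, hne, hCD, hchain⟩ := h.ellipticChain
  exact ⟨E, iX, C, CD, hP, hΔ, hne, hN, hCD, hchain⟩

/-- **The augmentation clause, re-derived over v2** (abc-iut-w5-d030's `range_aug_comp_refHom`, p440541): "so the
augmentation `Π ↠ Π/Δ` determines, by composition, an augmentation `Π_{U_N}(Π) ↠ Π/Δ`" — the image is EXACTLY `G_K`.
[claim: Mochizuki2012, status: disputed] (IUTchII §1 Prop 1.6 (ii), kurims p.31) -/
theorem range_aug_comp_refHom (h : K.RefIsEllipticChain X U eX eU) :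
    (X.aug.toMonoidHom.comp (K.refHom X U eX eU)).range = X.GK :=
  h.toRefIsElliptic.range_aug_comp_refHom

/-- **Re-derived over v2** (abc-iut-w5-d030's `exists_aug_refHom_eq`): every element of `G_K` is the augmentation of
some element coming from `Π^tp_U`. [claim: Mochizuki2012, status: disputed] (IUTchII §1 Prop 1.6 (ii), kurims p.31) -/
theorem exists_aug_refHom_eq (h : K.RefIsEllipticChain X U eX eU)
    {g : Literature.AnabelianGeometry.SemiGraphs.GQp p} (hg : g ∈ X.GK) :
    ∃ y : U.PiTemp, X.aug (K.refHom X U eX eU y) = g :=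
  h.toRefIsElliptic.exists_aug_refHom_eq hg

/-- **Stability under the functorial transport** of the output along `P ≃ₜ* P'` (the reference side does not move).
[claim: Mochizuki2012, status: disputed] (IUTchII §1 Prop 1.6 (ii), kurims p.31) -/
theorem transport (h : K.RefIsEllipticChain X U eX eU) (f : P ≃ₜ* P') :
    (K.transport f).RefIsEllipticChain X U eX eU where
  toRefIsElliptic := h.toRefIsElliptic.transport f
  ellipticChain := h.ellipticChain

/-! ### Non-degeneracy -/

/-- **The cusp tie is load-bearing**: under v2 with `N ≥ 2` the tempered curve `X` HAS A CUSP recorded by the chain's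
cuspidal data — the first de-cuspidalization step of the realized chain is performed at a (3_Π) cuspidal decomposition
group of some recorded cusp, which `IsCuspidalDataOf` ties to a cusp of `X`.
[cite: MochizukiAbsTopII2013, Cor 3.3 (iii)(a) p.68] -/
theorem exists_isCusp_of_two_le (h : K.RefIsEllipticChain X U eX eU) (hN : 2 ≤ (N : ℕ)) :
    ∃ x : X.Pt, X.IsCusp x := by
  obtain ⟨E, iX, C, -, hCN, -, -, CD, hP, hΔ, hne, hCD, hchain⟩ := h.ellipticChain
  obtain ⟨c, -, -, -, s, t, v, hst, htv, hvl, -, -, -, -, -, -, ψ, -, -, -, -, hsteps, -⟩ := hchain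
  have hNsq : 1 ≤ C.N ^ 2 - 1 := by
    have : 2 ^ 2 ≤ C.N ^ 2 := Nat.pow_le_pow_left (hCN ▸ hN) 2
    omega
  have hlt : s.val < t.val := by omega
  have hslen : s.val < c.len := by omega
  obtain ⟨φ, hde, -⟩ := hsteps ⟨s.val, hslen⟩ (le_refl _) hlt
  obtain ⟨-, -, D, hDmem, -⟩ := hde
  obtain ⟨cusp, -⟩ := hDmem
  obtain ⟨x, hx, -⟩ := hCD.1 cusp
  exact ⟨x, hx⟩

/-- **NON-DEGENERACY of the strengthened predicate.**  If the tempered reference surjection `Π^tp_U ↠ Π^tp_X` COMPLETES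
TO AN ISOMORPHISM of profinite groups — some `f : Π̂_U ⥲ Π̂_X` with `f ∘ toHat_U = toHat_X ∘ refHom` (as happens for the
identity output) — then (R2′) FAILS for every `N ≥ 2`: the completion square of (R2′) and the density of
`Π^temp ↪ Π̂` ([SemiAnbd] §6 p. 69, `IsProfiniteCompletion.denseRange`) force the record's output `Π_{U_X} ↠ Π'` to be
`iX ∘ f ∘ iU⁻¹`, hence INJECTIVE, while a record realizing the printed chain of level `≥ 2` has non-injective output
(`AbsTopII.EllipticCuspidalization.RealizesChain.proj_not_injective_of_two_le`: the `N² − 1 ≥ 1` de-cuspidalization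
steps kill a nontrivial (3_Π) cuspidal decomposition group). [cite: MochizukiAbsTopII2013, Cor 3.3 (iii)(a) p.68] -/
theorem not_of_completesToIso (hN : 2 ≤ (N : ℕ)) (f : U.PiHat ≃ₜ* X.PiHat)
    (hf : ∀ y : U.PiTemp, f (U.toHat y) = X.toHat (K.refHom X U eX eU y)) :
    ¬ K.RefIsEllipticChain X U eX eU := by
  intro h
  obtain ⟨E, iX, C, iU, hCN, -, hsq, CD, hP, hΔ, hne, -, hchain⟩ := h.ellipticChain
  -- the completion square at the profinite level: `C.proj ∘ iU = iX ∘ f` on `Π̂_U`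
  have hdense : DenseRange U.toHat := U.isProfiniteCompletion_toHat.denseRange
  have heq : (fun z : U.PiHat => C.proj.arith (iU z)) = fun z => iX (f z) := by
    refine Continuous.ext_on hdense ((map_continuous C.proj.arith).comp iU.continuous)
      (iX.continuous.comp f.continuous) ?_
    rintro _ ⟨y, rfl⟩
    show C.proj.arith (iU (U.toHat y)) = iX (f (U.toHat y))
    rw [hf y]
    exact hsq y
  -- hence the output `Π_{U_X} ↠ Π'` of the record is injective …
  have hinj : Function.Injective C.proj.arith := by
    intro a b hab
    have ha := congrFun heq (iU.symm a)
    have hb := congrFun heq (iU.symm b)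
    simp only [ContinuousMulEquiv.apply_symm_apply] at ha hb
    have hfab : iX (f (iU.symm a)) = iX (f (iU.symm b)) := by rw [← ha, ← hb, hab]
    exact iU.symm.injective (f.injective (iX.injective hfab))
  -- … against the chain of level `N ≥ 2`
  have h2 : 2 ≤ C.N := hCN ▸ hN
  exact hchain.proj_not_injective_of_two_le h2 hinj

/-- **Corollary (the identity shape).** If `U = X` and the tempered reference surjection is the IDENTITY of `Π^tp_X`
(no cusp removed — the shape of abc-iut-L6-t21's identity witness p447116, `IdentityWitness.refHom_idOutput_apply`),
then (R2′) fails for every `N ≥ 2`. [claim: Mochizuki2012, status: disputed] (IUTchII §1 Prop 1.6 (ii), kurims p.31) -/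
theorem not_of_refHom_eq_self {K : EllipticCuspidalization S N P} {X : TemperedCurve p} {eX : X.PiTemp ≃ₜ* S.PiX}
    {eU : X.PiTemp ≃ₜ* K.PiURef} (hN : 2 ≤ (N : ℕ)) (hid : ∀ y : X.PiTemp, K.refHom X X eX eU y = y) :
    ¬ K.RefIsEllipticChain X X eX eU :=
  not_of_completesToIso hN (ContinuousMulEquiv.refl X.PiHat) fun y => by rw [hid y]; rfl

end RefIsEllipticChain


end EllipticCuspidalization

end Literature.IUT.HodgeArakelov
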